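import Literature.LinearAlgebra.Matrix.BipartiteForestRootCofactor
import Literature.LinearAlgebra.Matrix.BipartiteForestCofactor
import Literature.NumberTheory.EllipticCurves.Smith2016.CongruentNumberGenusDeterminantReciprocityForest
import Literature.NumberTheory.EllipticCurves.Smith2016.CongruentNumberGenusDeterminantBlocks
import HarnessLib

/-!
# Route `PrintCf2`, crux stmt-BirchSwinnertonDyer-20509 `RamifiedOffTYZOfFacts` — the Q-form identity (★): FOREST LAYER (F1a)
# (cell `bsd-print-cf2`, LEAD of 20509 g6, line `offtyz-v7`, cycle 7; kernel helpers `--supports stmt-BirchSwinnertonDyer-20509`)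

First kernel layer of the proof of g5's conjecture (★) `Q_n = q(κ_n)` (crux workfile
`Cruxes/RamifiedOffTYZOfFacts/Lines/offtyz_v7_QFormProof.md`, §0–§2; `…/offtyz_v7_QForm.md` §4/§11 for the statement). Everything here is
ABSTRACT: arc weights `a : V → V → 𝔽₂` subject to the RECIPROCITY LAW `a s t + a t s = y s * y t` (`s ≠ t`; for Monsky's additive Legendre
matrix this is quadratic reciprocity, `y = ((−1/pᵢ)₊)`), and a second vector `z` (`= ((2/pᵢ)₊)`), in the vocabulary of the tree's bipartite
all-minors forest formula (`Literature/LinearAlgebra/Matrix/BipartiteForest*.lean`: `lap`, `treeDet` = `κ_t`, `qwt` = `q_x`, `fwt`, `bigN`,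
`setExp`) and of Smith 2016 §2 as typed in `Literature/NumberTheory/EllipticCurves/Smith2016/*Forest*.lean`.

* §1 ODD BLOCKS ARE FLAT: if `Σ_B y = 1` the columns of `L_B` indexed by `B` sum to zero (`indicator_vecMul_lap_eq_zero`), all cofactors along a
  row agree (`det_updateCol_lap_single_of_odd`), `κ_t(B)` is independent of `t` (`treeDet_eq_treeDet_of_odd`), `q_x(B) = (Σ_B x)·κ_c(B)`
  (`qwt_eq_sum_mul_treeDet_of_odd`), and the Smith/Monsky block weight `fwt a z z z B = (1 + Σ_B z) q_z(B)` vanishes (`fwt_self_eq_zero_of_odd`).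
* §2 PARITY IN FOREST FORM: `det (bigN a T z z z) = 0` for every nonempty `T` with `Σ_T y = 1` or `Σ_T z = 1` (`det_bigN_self_eq_zero`) — for
  Monsky's data this is the parity theorem «`s(n)` odd for `n ≡ 5, 7 (mod 8)`» (the symmetric form `bigN aᵀ z z z` of Monsky's matrix has the
  same kernel, note §1), proved here by one peel of the set exponential.
The cofactor sums over admissible blocks (shape of (★b)), mixed reciprocity and the principal cofactors of even blocks are the sibling file
`PrintCf2RamifiedOffTYZQFormForestCofactors.lean`. Pure linear algebra over `𝔽₂`; no number theory, no `sorry`. BSD is not proved by any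
of this; no class is closed.

References: [cite: Smith2016CongruentDensity, §2 Prop. 2.4 and §2.2 case 5(b)]; [cite: Chaiken1982, §2 (all minors matrix tree theorem)];
[cite: HeathBrown1994SelmerCongruentII, Appendix (Monsky), typescript p. 39 L27–L41 (the matrix M and the law (31))].
-/

namespace Summit.BirchSwinnertonDyer.PrintCf2.QFormForest

open Matrix Finset Literature.LinearAlgebra.Matrix Literature.Combinatorics.Enumerative
open Literature.NumberTheory.EllipticCurves.Smith2016

variable {V : Type*} [Fintype V] [LinearOrder V]

/-! ## §1. Odd blocks are flat -/

/-- **Column sums of an odd block vanish**: under the reciprocity law on `B` with `Σ_B y = 1`, the indicator vector of `B` is a LEFT null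
vector of the Laplacian-type block `L_B = lap a B 0` (column `j ∈ B`: `Σ_{r ≠ j} (a r j + a j r) = y_j (Σ_B y + y_j) = 0`).
[cite: HeathBrown1994SelmerCongruentII, Appendix (Monsky), typescript p. 39 L36–L41 (law (31): column sums of A when Σ uᵢ = 1)] -/
theorem indicator_vecMul_lap_eq_zero (a : V → V → ZMod 2) (y : V → ZMod 2) {B : Finset V}
    (hrec : ∀ i ∈ B, ∀ j ∈ B, i ≠ j → a i j + a j i = y i * y j) (hodd : ∑ i ∈ B, y i = 1) :
    (fun r => if r ∈ B then (1 : ZMod 2) else 0) ᵥ* lap a B 0 = 0 := by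
  ext j
  rw [Pi.zero_apply, vecMul, dotProduct]
  simp only [ite_mul, one_mul, zero_mul]
  rw [← sum_filter, filter_mem_eq_inter, univ_inter]
  by_cases hj : j ∈ B
  · have hcol : ∀ r ∈ B.erase j, lap a B 0 r j = a r j := fun r hr => by
      rw [lap_apply, if_pos (And.intro (mem_of_mem_erase hr) hj), if_neg (ne_of_mem_erase hr)]
    have hrow : ∀ r ∈ B.erase j, lap a B 0 j r = a j r := fun r hr => by
      rw [lap_apply, if_pos (And.intro hj (mem_of_mem_erase hr)), if_neg (ne_of_mem_erase hr).symm]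
    rw [← add_sum_erase B _ hj, lap_apply, if_pos (And.intro hj hj), if_pos rfl, Pi.zero_apply, zero_add,
      sum_congr rfl hcol, ← sum_add_distrib]
    have hpair : ∀ r ∈ B.erase j, (a j r + a r j) = y j * y r := fun r hr =>
      hrec j hj r (mem_of_mem_erase hr) (ne_of_mem_erase hr).symm
    rw [sum_congr rfl hpair, ← mul_sum]
    have hy : ∑ r ∈ B.erase j, y r = 1 + y j := by
      have h := add_sum_erase B y hj
      rw [hodd] at h
      have h2 : ∀ u v : ZMod 2, u + v = 1 → v = 1 + u := by decide
      exact h2 _ _ h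
    rw [hy]
    have h3 : ∀ u : ZMod 2, u * (1 + u) = 0 := by decide
    exact h3 _
  · refine sum_eq_zero fun r hr => ?_
    have hrj : r ≠ j := fun h => hj (h ▸ hr)
    rw [lap_apply, if_neg (fun h => hj h.2), if_neg hrj]

/-- **All cofactors along a row of an odd block agree**: for `t, c ∈ B` and `Σ_B y = 1`,
`det (L_B with column t ← e_c) = det (L_B with column t ← e_t)` (the indicator of `B` is a left null vector of the difference).
[cite: Smith2016CongruentDensity, §2.2 (chunk p0008 L42–L50: for d ≡ 3 (4) the column sums of A vanish and det Q is a multiple of one cofactor)] -/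
theorem det_updateCol_lap_single_of_odd (a : V → V → ZMod 2) (y : V → ZMod 2) {B : Finset V}
    (hrec : ∀ i ∈ B, ∀ j ∈ B, i ≠ j → a i j + a j i = y i * y j) (hodd : ∑ i ∈ B, y i = 1)
    {t c : V} (ht : t ∈ B) (hc : c ∈ B) :
    ((lap a B 0).updateCol t (Pi.single c 1)).det = ((lap a B 0).updateCol t (Pi.single t 1)).det := by
  have hdec : (Pi.single c (1 : ZMod 2) : V → ZMod 2) = Pi.single t 1 + (Pi.single c 1 - Pi.single t 1) := by abel
  rw [hdec, det_updateCol_add]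
  suffices h0 : ((lap a B 0).updateCol t (Pi.single c 1 - Pi.single t 1)).det = 0 by rw [h0, add_zero]
  refine Matrix.exists_vecMul_eq_zero_iff.mp ⟨fun r => if r ∈ B then (1 : ZMod 2) else 0, ?_, ?_⟩
  · intro h
    have := congrFun h t
    simp [ht] at this
  · ext j
    rw [Pi.zero_apply, vecMul, dotProduct]
    by_cases hjt : j = t
    · subst hjt
      simp only [updateCol_self, Pi.sub_apply, Pi.single_apply, ite_mul, one_mul, zero_mul]
      rw [← sum_filter, filter_mem_eq_inter, univ_inter]
      rw [sum_sub_distrib, sum_ite_eq' B c, sum_ite_eq' B j, if_pos hc, if_pos ht, sub_self]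
    · have h := congrFun (indicator_vecMul_lap_eq_zero a y hrec hodd) j
      rw [Pi.zero_apply, vecMul, dotProduct] at h
      refine Eq.trans (sum_congr rfl fun r _ => ?_) h
      rw [updateCol_ne hjt]

/-- **`κ_c(B) = κ_t(B)` on an odd block**: the mod-2 number of spanning arborescences of `B` converging to `t` does not depend on `t` when
`Σ_B y = 1`. [cite: Smith2016CongruentDensity, §2.2 (chunk p0008 L42–L50)] -/
theorem treeDet_eq_treeDet_of_odd (a : V → V → ZMod 2) (y : V → ZMod 2) {B : Finset V}
    (hrec : ∀ i ∈ B, ∀ j ∈ B, i ≠ j → a i j + a j i = y i * y j) (hodd : ∑ i ∈ B, y i = 1)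
    {t c : V} (ht : t ∈ B) (hc : c ∈ B) : treeDet a B c = treeDet a B t := by
  have h := det_updateCol_lap_single_of_odd a y hrec hodd ht hc
  rw [det_updateCol_single_eq_det_updateRow_single, det_updateCol_single_eq_det_updateRow_single,
    det_updateRow_lap_single a hc ht, ← det_unitize, ← det_unitize, unitize_lap a hc, unitize_lap a ht] at h
  rw [treeDet, treeDet]
  exact h

/-- **`q_x(B) = (Σ_B x) · κ_c(B)` on an odd block** (any `c ∈ B`). [cite: Smith2016CongruentDensity, §2.2 (chunk p0008 L42–L50)] -/
theorem qwt_eq_sum_mul_treeDet_of_odd (a : V → V → ZMod 2) (y x : V → ZMod 2) {B : Finset V}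
    (hrec : ∀ i ∈ B, ∀ j ∈ B, i ≠ j → a i j + a j i = y i * y j) (hodd : ∑ i ∈ B, y i = 1) {c : V} (hc : c ∈ B) :
    qwt a x B = (∑ i ∈ B, x i) * treeDet a B c := by
  rw [qwt, sum_mul]
  exact sum_congr rfl fun t ht => by rw [treeDet_eq_treeDet_of_odd a y hrec hodd ht hc]

omit [Fintype V] [LinearOrder V] in
/-- An odd block is nonempty. [folklore] -/
theorem nonempty_of_sum_eq_one {f : V → ZMod 2} {B : Finset V} (h : ∑ i ∈ B, f i = 1) : B.Nonempty := by
  rw [nonempty_iff_ne_empty]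
  rintro rfl
  rw [sum_empty] at h
  exact zero_ne_one h

/-- **The Smith/Monsky block weight of an odd block vanishes**: `fwt a z z z B = (1 + Σ_B z)·q_z(B) = (1 + Σ_B z)(Σ_B z) κ = 0` when
`Σ_B y = 1`. [cite: Smith2016CongruentDensity, §2 Thm. 2.2 row 1 with Table 2 (blocks d ≡ 3 (4) carry weight 0)] -/
theorem fwt_self_eq_zero_of_odd (a : V → V → ZMod 2) (y z : V → ZMod 2) {B : Finset V}
    (hrec : ∀ i ∈ B, ∀ j ∈ B, i ≠ j → a i j + a j i = y i * y j) (hodd : ∑ i ∈ B, y i = 1) :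
    fwt a z z z B = 0 := by
  obtain ⟨c, hc⟩ := nonempty_of_sum_eq_one hodd
  rw [fwt, qwt_eq_sum_mul_treeDet_of_odd a y z hrec hodd hc]
  have h : ∀ u v : ZMod 2, u * (u * v) + u * v = 0 := by decide
  exact h _ _

/-- **A block with odd `z`-content weighs zero**: `fwt a z z z B = (1 + Σ_B z) q_z(B) = 0` when `Σ_B z = 1` (no reciprocity needed).
[cite: Smith2016CongruentDensity, §2 Thm. 2.2 row 1 (the factor (1 + Σ_S zᵢ))] -/
theorem fwt_self_eq_zero_of_sum_z (a : V → V → ZMod 2) (z : V → ZMod 2) {B : Finset V} (hz : ∑ i ∈ B, z i = 1) :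
    fwt a z z z B = 0 := by
  rw [fwt, hz, one_mul]
  exact CharTwo.add_self_eq_zero _

/-! ## §2. Parity in forest form -/

omit [Fintype V] [LinearOrder V] in
/-- Restricting the reciprocity law to a sub-block. [folklore] -/
theorem hrec_mono {a : V → V → ZMod 2} {y : V → ZMod 2} {D B : Finset V} (hBD : B ⊆ D)
    (hrec : ∀ i ∈ D, ∀ j ∈ D, i ≠ j → a i j + a j i = y i * y j) :
    ∀ i ∈ B, ∀ j ∈ B, i ≠ j → a i j + a j i = y i * y j :=
  fun i hi j hj hij => hrec i (hBD hi) j (hBD hj) hij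

/-- **Parity theorem, forest form**: for a nonempty vertex set `T` under the reciprocity law with `Σ_T y = 1` OR `Σ_T z = 1`,
`det (bigN a T z z z) = 0` — every set partition of `T` has a block `C` with `Σ_C y = 1` or `Σ_C z = 1`, whose weight `fwt a z z z C`
vanishes (§1). For Monsky's data (`a` = transposed additive Legendre matrix) this is «`s(n)` is odd for `n ≡ 5, 7 (mod 8)`».
[cite: HeathBrown1994SelmerCongruentII, Appendix (Monsky), typescript p. 40 L1–L31 (s(D) odd for D ≡ 5, 6, 7 mod 8)] -/
theorem det_bigN_self_eq_zero (a : V → V → ZMod 2) (y z : V → ZMod 2) :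
    ∀ (T : Finset V), (∀ i ∈ T, ∀ j ∈ T, i ≠ j → a i j + a j i = y i * y j) → T.Nonempty →
      (∑ i ∈ T, y i = 1 ∨ ∑ i ∈ T, z i = 1) → (bigN a T z z z).det = 0 := by
  suffices H : ∀ (n : ℕ) (T : Finset V), T.card = n → (∀ i ∈ T, ∀ j ∈ T, i ≠ j → a i j + a j i = y i * y j) →
      T.Nonempty → (∑ i ∈ T, y i = 1 ∨ ∑ i ∈ T, z i = 1) → (bigN a T z z z).det = 0 from fun T => H _ T rfl
  intro n
  induction n using Nat.strong_induction_on with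
  | _ n ih =>
  intro T hn hrec hT hpar
  obtain ⟨s, hs⟩ := hT
  rw [det_bigN_eq_setExp, setExp_peel _ hs]
  refine sum_eq_zero fun B₀ hB₀ => ?_
  rw [mem_powerset] at hB₀
  set B := insert s B₀ with hB
  have hBT : B ⊆ T := insert_subset hs (hB₀.trans (erase_subset s T))
  have hsB₀ : s ∉ B₀ := fun h => notMem_erase s T (hB₀ h)
  have hsplit : ∀ f : V → ZMod 2, ∑ i ∈ T, f i = ∑ i ∈ B, f i + ∑ i ∈ T.erase s \ B₀, f i := by
    intro f
    have hdisj : Disjoint B (T.erase s \ B₀) := by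
      rw [hB, disjoint_insert_left]
      exact ⟨fun h => notMem_erase s T (mem_sdiff.mp h).1, disjoint_sdiff⟩
    rw [← sum_union hdisj]
    congr 1
    ext x
    simp only [hB, mem_union, mem_insert, mem_sdiff, mem_erase]
    constructor
    · intro hx
      by_cases hxs : x = s
      · exact Or.inl (Or.inl hxs)
      · by_cases hxB : x ∈ B₀
        · exact Or.inl (Or.inr hxB)
        · exact Or.inr ⟨⟨hxs, hx⟩, hxB⟩
    · rintro ((rfl | hx) | ⟨⟨_, hx⟩, _⟩)
      · exact hs
      · exact hBT (mem_insert_of_mem hx)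
      · exact hx
  -- either the pointed block already weighs zero, or the rest inherits the odd sum and is smaller
  by_cases hyB : ∑ i ∈ B, y i = 1
  · rw [fwt_self_eq_zero_of_odd a y z (hrec_mono hBT hrec) hyB, zero_mul]
  by_cases hzB : ∑ i ∈ B, z i = 1
  · rw [fwt_self_eq_zero_of_sum_z a z hzB, zero_mul]
  have h01 : ∀ u : ZMod 2, u ≠ 1 → u = 0 := by decide
  have hyB0 := h01 _ hyB
  have hzB0 := h01 _ hzB
  set R := T.erase s \ B₀ with hR
  have hparR : ∑ i ∈ R, y i = 1 ∨ ∑ i ∈ R, z i = 1 := by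
    rcases hpar with h | h
    · left; rw [hsplit y, hyB0, zero_add] at h; exact h
    · right; rw [hsplit z, hzB0, zero_add] at h; exact h
  have hRne : R.Nonempty := by
    rcases hparR with h | h <;> exact nonempty_of_sum_eq_one h
  have hRT : R ⊆ T := (sdiff_subset).trans (erase_subset s T)
  have hcard : R.card < n := by
    rw [← hn]
    exact lt_of_le_of_lt (card_le_card sdiff_subset) (card_erase_lt_of_mem hs)
  rw [← det_bigN_eq_setExp, ih R.card hcard R rfl (hrec_mono hRT hrec) hRne hparR, mul_zero]


omit [Fintype V] [LinearOrder V] in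
/-- Splitting a sum over `D` along the pointed block `{j} ∪ B₀` and its complement `(D ∖ j) ∖ B₀`.
[cite: Stanley1999EC2, Cor. 5.1.6 (exponential formula; elementary finite form)] -/
theorem sum_eq_sum_insert_add_sum_sdiff [DecidableEq V] (f : V → ZMod 2) {D : Finset V} {j : V} (hj : j ∈ D)
    {B₀ : Finset V} (hB₀ : B₀ ⊆ D.erase j) :
    ∑ i ∈ D, f i = ∑ i ∈ insert j B₀, f i + ∑ i ∈ D.erase j \ B₀, f i := by
  have hdisj : Disjoint (insert j B₀) (D.erase j \ B₀) := by
    rw [disjoint_insert_left]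
    exact ⟨fun h => notMem_erase j D (mem_sdiff.mp h).1, disjoint_sdiff⟩
  rw [← sum_union hdisj]
  congr 1
  ext x
  simp only [mem_union, mem_insert, mem_sdiff, mem_erase]
  constructor
  · intro hx
    by_cases hxs : x = j
    · exact Or.inl (Or.inl hxs)
    · by_cases hxB : x ∈ B₀
      · exact Or.inl (Or.inr hxB)
      · exact Or.inr ⟨⟨hxs, hx⟩, hxB⟩
  · rintro ((rfl | hx) | ⟨⟨_, hx⟩, _⟩)
    · exact hj
    · exact mem_of_mem_erase (hB₀ hx)
    · exact hx

end Summit.BirchSwinnertonDyer.PrintCf2.QFormForest
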